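import Summits.BirchSwinnertonDyer.BirchSwinnertonDyer.Theorems.GenusKolyvaginAtTwoTorsionCellSELTwistParam
import HarnessLib

/-!
# SEL (iso-class Selmer pair law), V-e: the count `#Sel⁽²⁾(E^{(M)}/ℚ) = 4 · #ker Φ₃(Ĝ)`

Crux R″ `RankOneTwoTorsionResidualAtTwo` (stmt-27478), LINE 49 «full_vertex», SUPPORT stub SEL
`IsoClassSelmerPairLawAtTwo` — its `C₀ = E₀^{(M₀)}` HALF in symbol form, for an iso-class set `Q` of full-admissible primes
of ANY even size (pen bsd-idea-1 memo #2/#3; the tree's `k = 0, 2` cases were `…D0NegPrimeTwistCount` /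
`…D0PairTwistCount`).  Setting of parts II–V-d: `E/ℚ` with rational `2`-torsion `e₁, e₂, e₃`, rank `0`, `Ш(E)[2] = 0`;
`S ∋ 2` a finite set of primes supporting `N_E` and the root differences; `Q ≠ ∅` a finite set of primes `≡ 3 (mod 4)` of
even size, disjoint from `S`, pairwise in one square class at every `ℓ ∈ S` (`q ≡ q' (mod 8)`, `(qq'/ℓ) = 1`), each
full-admissible (`δ₁, δ₂` non-residues), with common bit `ε = qr_q(e₂ − e₁)`; `M = ∏_{q∈Q} q`; `Ĝ = redeiLaplacian Q`.

* **`natCard_selmerGroup_twist_isoClass_eq`** — `Nat.card (Sel⁽²⁾(E^{(M)}/ℚ)) = 4 · Nat.card (ker Φ₃(Ĝ))`.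

Proof: the map `(torsion pair t, solution χ of Φ₃(Ĝ)χ = c_t𝟙) ↦ c_{E^{(M)}}(t₁∏_{supp χ} i, t₂∏_{supp χ_b} i)` (part V-d)
from the disjoint union of the four fibres is a bijection onto the Selmer group (injective by the parity and residue bits
of the components, surjective by part V-d), and each fibre has `#ker Φ₃(Ĝ)` elements (part V-a).
Everything is proved; no LINE 49 statement is restated; BSD is not advanced by this file alone.

## References

* [SilvermanAEC2009] J. H. Silverman, *The Arithmetic of Elliptic Curves*, 2nd ed., Prop. X.1.4, Thm. X.4.2, Prop. X.4.9.
* [Kane2013SelmerTwists] D. M. Kane, Algebra Number Theory 7 (2013), §2.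
* [HeathBrown1994SelmerCongruentII] D. R. Heath-Brown, Invent. Math. 118 (1994), §2, Thm. 1.
-/

noncomputable section

open scoped Classical

namespace Summit.BirchSwinnertonDyer.BirchSwinnertonDyer.Theorems.GenusKolyvaginAtTwo.TorsionCellSEL

open WeierstrassCurve WeierstrassCurve.Affine WeierstrassCurve.Affine.Point
open Literature.NumberTheory.GaloisRepresentations Literature.NumberTheory.EllipticCurves Field
open Literature.NumberTheory.EllipticCurves.TwoDescentLocal
open Literature.NumberTheory.EllipticCurves.KramerTwoDescent
open Summit.BirchSwinnertonDyer.BirchSwinnertonDyer.Theorems.GenusKolyvaginAtTwo.TorsionCellD0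
open Summit.BirchSwinnertonDyer.BirchSwinnertonDyer.Theorems.GenusKolyvaginAtTwo.FullVertex
open IsDedekindDomain NumberField Rat.HeightOneSpectrum Matrix

section Count

variable (E : WeierstrassCurve ℚ) [E.IsElliptic] {e₁ e₂ e₃ : ℚ} (S Q : Finset ℕ)

/-- `𝔽₂` arithmetic. [folklore] -/
private theorem zmod2_cases (x : ZMod 2) : x = 0 ∨ x = 1 := by revert x; decide

/-- **THE `C₀` HALF OF THE ISO-CLASS SELMER PAIR LAW, symbol form**: in the setting of the module docstring,
`#Sel⁽²⁾(E^{(M)}/ℚ) = 4 · #ker Φ₃(Ĝ)` where `Ĝ = redeiLaplacian Q` is LINE 49's Rédei–Laplacian and `Φ₃(X) = X² + X + 1`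
(so `dim_𝔽₂ Sel⁽²⁾(E^{(M)}) = 2 + dim ker Φ₃(Ĝ)`).  [cite: SilvermanAEC2009, Prop. X.1.4, Thm. X.4.2, Prop. X.4.9]
[cite: Kane2013SelmerTwists, §2] [cite: HeathBrown1994SelmerCongruentII, §2, Thm. 1] -/
theorem natCard_selmerGroup_twist_isoClass_eq (h : E.toAffine.SplitTwoTorsion e₁ e₂ e₃) (hS : ∀ ℓ ∈ S, ℓ.Prime)
    (h2S : 2 ∈ S)
    (hgood : ∀ ℓ : ℕ, (hℓ : ℓ.Prime) → ℓ ∉ S → haveI : Fact ℓ.Prime := ⟨hℓ⟩;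
      padicValRat ℓ (e₁ - e₂) = 0 ∧ padicValRat ℓ (e₁ - e₃) = 0 ∧ padicValRat ℓ (e₂ - e₃) = 0)
    (hN : ∀ ℓ : ℕ, ℓ.Prime → ℓ ∉ S → ¬ ℓ ∣ E.conductorNorm ℤ)
    (hrank : E.mordellWeilRank = 0) (hsha : ∀ x ∈ E.sha, (2 : ℕ) • x = 0 → x = 0)
    (hQ : ∀ q ∈ Q, q.Prime) (hQS : ∀ q ∈ Q, q ∉ S) (hQ4 : ∀ q ∈ Q, q % 4 = 3) (hk : Even Q.card)
    {q₀ : ℕ} (hq₀ : q₀ ∈ Q)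
    (hiso8 : ∀ q ∈ Q, ∀ q' ∈ Q, q % 8 = q' % 8)
    (hisoS : ∀ q ∈ Q, ∀ q' ∈ Q, ∀ ℓ ∈ S, (hℓ : ℓ.Prime) → ℓ ≠ 2 → haveI : Fact ℓ.Prime := ⟨hℓ⟩;
      legendreSym ℓ ((q : ℤ) * q') = 1)
    (hadm : ∀ q ∈ Q, (hq : q.Prime) → haveI : Fact q.Prime := ⟨hq⟩;
      qrBit q ((e₁ - e₂) * (e₁ - e₃)) = 1 ∧ qrBit q ((e₂ - e₁) * (e₂ - e₃)) = 1)
    {ε : ZMod 2} (hε : ∀ q ∈ Q, (hq : q.Prime) → haveI : Fact q.Prime := ⟨hq⟩; qrBit q (e₂ - e₁) = ε)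
    {d : ℚ} (hd : d = ∏ q ∈ Q, (q : ℚ)) [(E.quadraticTwist d).IsElliptic] :
    Nat.card (selmerGroup (E.quadraticTwist d) 2) = 4 * Nat.card (LinearMap.ker (phi3 (redeiLaplacian Q)).mulVecLin) := by
  haveI hq₀F : Fact q₀.Prime := ⟨hQ q₀ hq₀⟩
  have h' := h.quadraticTwist d
  have hQ0 : ∀ q ∈ Q, (q : ℚ) ≠ 0 := fun q hq => by exact_mod_cast (hQ q hq).ne_zero
  have he12 : e₁ - e₂ ≠ 0 := sub_ne_zero.mpr h.ne₁₂
  have he21 : e₂ - e₁ ≠ 0 := sub_ne_zero.mpr h.ne₁₂.symm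
  have he13 : e₁ - e₃ ≠ 0 := sub_ne_zero.mpr h.ne₁₃
  have he31 : e₃ - e₁ ≠ 0 := sub_ne_zero.mpr h.ne₁₃.symm
  have he23 : e₂ - e₃ ≠ 0 := sub_ne_zero.mpr h.ne₂₃
  have he32 : e₃ - e₂ ≠ 0 := sub_ne_zero.mpr h.ne₂₃.symm
  -- indicator sets of vectors (a choice, abstracted)
  obtain ⟨As, hAs_sub, hAs_ind⟩ : ∃ As : (Q → ZMod 2) → Finset ℕ,
      (∀ χ, As χ ⊆ Q) ∧ ∀ χ (i : Q), χ i = (if (i : ℕ) ∈ As χ then 1 else 0) :=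
    ⟨fun χ => Classical.choose (exists_finset_of_indicator Q χ),
      fun χ => (Classical.choose_spec (exists_finset_of_indicator Q χ)).1,
      fun χ => (Classical.choose_spec (exists_finset_of_indicator Q χ)).2⟩
  have hprod : ∀ χ, ∏ i ∈ As χ, (i : ℚ) ≠ 0 := fun χ => Finset.prod_ne_zero_iff.mpr fun i hi => hQ0 i (hAs_sub χ hi)
  have hAs_eq : ∀ χ {A : Finset ℕ}, A ⊆ Q → (∀ i : Q, χ i = (if (i : ℕ) ∈ A then 1 else 0)) → As χ = A :=
    fun χ A hA hind => finset_eq_of_indicator_eq Q (hAs_sub χ) hA fun i => by rw [← hAs_ind χ i, hind i]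
  -- the `b`-vector of a solution and the class map (abstracted)
  obtain ⟨bv, hbv⟩ : ∃ bv : ZMod 2 → (Q → ZMod 2) → (Q → ZMod 2),
      ∀ τ₁ χ, bv τ₁ χ = fun j => τ₁ + (redeiLaplacian Q *ᵥ χ) j + ε * χ j := ⟨_, fun _ _ => rfl⟩
  obtain ⟨cls, hcls⟩ : ∃ cls : ℚˣ → ℚˣ → ZMod 2 → (Q → ZMod 2) → galH1Torsion (E.quadraticTwist d) 2,
      ∀ t₁ t₂ τ₁ χ, cls t₁ t₂ τ₁ χ = (E.quadraticTwist d).twoDescentClass h' (t₁ * Units.mk0 _ (hprod χ))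
        (t₂ * Units.mk0 _ (hprod (bv τ₁ χ))) := ⟨_, fun _ _ _ _ => rfl⟩
  -- (1) solutions give Selmer classes
  have hmem : ∀ (t₁ t₂ : ℚˣ) (τ₁ τ₂ : ZMod 2), E.twoDescentClass h t₁ t₂ ∈ E.selmerGroup 2 →
      (∀ q ∈ Q, (hq : q.Prime) → haveI : Fact q.Prime := ⟨hq⟩;
        parityBit q (t₁ : ℚ) = 0 ∧ parityBit q (t₂ : ℚ) = 0 ∧ qrBit q (t₁ : ℚ) = τ₁ ∧ qrBit q (t₂ : ℚ) = τ₂) →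
      ∀ χ : Q → ZMod 2, (phi3 (redeiLaplacian Q) *ᵥ χ = fun _ => τ₂ + (ε + 1) * τ₁) →
        cls t₁ t₂ τ₁ χ ∈ selmerGroup (E.quadraticTwist d) 2 := by
    intro t₁ t₂ τ₁ τ₂ ht hτ χ hχ
    rw [hcls]
    exact twoDescentClass_mem_selmerGroup_of_phi3 E S Q h hS h2S hgood hN hQ hQS hQ4 hk hiso8 hisoS hadm hε hd ht hτ hχ
      (hAs_sub χ) (hAs_sub _) (hAs_ind χ) (fun j => by rw [← hAs_ind (bv τ₁ χ) j, hbv]) (hprod χ) (hprod _)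
  -- (2) the bits of the components of `cls`
  have hbitsA : ∀ (t₁ t₂ : ℚˣ) (τ₁ : ZMod 2) (χ : Q → ZMod 2) (q : ℕ) (hq : q ∈ Q), haveI : Fact q.Prime := ⟨hQ q hq⟩;
      parityBit q ((t₁ : ℚ) * ∏ i ∈ As χ, (i : ℚ)) = parityBit q (t₁ : ℚ) + χ ⟨q, hq⟩ := by
    intro t₁ t₂ τ₁ χ q hq
    haveI : Fact q.Prime := ⟨hQ q hq⟩
    rw [parityBit_mul t₁.ne_zero (hprod χ), parityBit_prod_primes (fun i hi => hQ i (hAs_sub χ hi)) q, ← hAs_ind χ ⟨q, hq⟩]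
  -- (3) injectivity of the parametrisation across torsion pairs
  have hinj : ∀ (t₁ t₂ : ℚˣ) (τ₁ τ₂ : ZMod 2) (t₁' t₂' : ℚˣ) (τ₁' τ₂' : ZMod 2) (χ χ' : Q → ZMod 2),
      (∀ q ∈ Q, (hq : q.Prime) → haveI : Fact q.Prime := ⟨hq⟩;
        parityBit q (t₁ : ℚ) = 0 ∧ parityBit q (t₂ : ℚ) = 0 ∧ qrBit q (t₁ : ℚ) = τ₁ ∧ qrBit q (t₂ : ℚ) = τ₂) →
      (∀ q ∈ Q, (hq : q.Prime) → haveI : Fact q.Prime := ⟨hq⟩;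
        parityBit q (t₁' : ℚ) = 0 ∧ parityBit q (t₂' : ℚ) = 0 ∧ qrBit q (t₁' : ℚ) = τ₁' ∧ qrBit q (t₂' : ℚ) = τ₂') →
      cls t₁ t₂ τ₁ χ = cls t₁' t₂' τ₁' χ' → χ = χ' ∧ τ₁ = τ₁' ∧ τ₂ = τ₂' := by
    intro t₁ t₂ τ₁ τ₂ t₁' t₂' τ₁' τ₂' χ χ' hτ hτ' heq
    rw [hcls, hcls] at heq
    -- equal components
    have hc₁ := mk_eq_mk_of_kummerEquiv_eq
      ((E.quadraticTwist d).kummerEquiv_twoTorsionCharH1_twoDescentClass h' (t₁ * Units.mk0 _ (hprod χ))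
        (t₂ * Units.mk0 _ (hprod (bv τ₁ χ))))
      (by rw [heq]; exact (E.quadraticTwist d).kummerEquiv_twoTorsionCharH1_twoDescentClass h' _ _)
    have hc₂ := mk_eq_mk_of_kummerEquiv_eq
      ((E.quadraticTwist d).kummerEquiv_twoTorsionCharH1_swap_twoDescentClass h' (t₁ * Units.mk0 _ (hprod χ))
        (t₂ * Units.mk0 _ (hprod (bv τ₁ χ))))
      (by rw [heq]; exact (E.quadraticTwist d).kummerEquiv_twoTorsionCharH1_swap_twoDescentClass h' _ _)
    -- parities on `Q`: `χ = χ'`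
    have hχ : χ = χ' := by
      ext ⟨q, hq⟩
      haveI : Fact q.Prime := ⟨hQ q hq⟩
      have hp := parityBit_eq_of_mk_eq q hc₁
      rw [Units.val_mul, Units.val_mk0, Units.val_mul, Units.val_mk0] at hp
      have h1 := hbitsA t₁ t₂ τ₁ χ q hq
      have h2 := hbitsA t₁' t₂' τ₁' χ' q hq
      rw [h1, h2, (hτ q hq (hQ q hq)).1, (hτ' q hq (hQ q hq)).1] at hp
      simpa using hp
    subst hχ
    -- residues at `q₀`: `τ₁ = τ₁'`
    have hτ₁ : τ₁ = τ₁' := by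
      have hr := qrBit_eq_of_mk_eq q₀ hc₁
      rw [Units.val_mul, Units.val_mk0, Units.val_mul, Units.val_mk0, qrBit_mul q₀ t₁.ne_zero (hprod χ),
        qrBit_mul q₀ t₁'.ne_zero (hprod χ), (hτ q₀ hq₀ hq₀F.out).2.2.1, (hτ' q₀ hq₀ hq₀F.out).2.2.1] at hr
      simpa using hr
    subst hτ₁
    refine ⟨rfl, rfl, ?_⟩
    have hr := qrBit_eq_of_mk_eq q₀ hc₂
    rw [Units.val_mul, Units.val_mk0, Units.val_mul, Units.val_mk0, qrBit_mul q₀ t₂.ne_zero (hprod _),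
      qrBit_mul q₀ t₂'.ne_zero (hprod _), (hτ q₀ hq₀ hq₀F.out).2.2.2, (hτ' q₀ hq₀ hq₀F.out).2.2.2] at hr
    simpa using hr
  -- (4) surjectivity: every Selmer class is a `cls`
  have hsurj : ∀ c ∈ selmerGroup (E.quadraticTwist d) 2, ∃ (t₁ t₂ : ℚˣ) (τ₁ τ₂ : ZMod 2) (χ : Q → ZMod 2),
      ((((t₁ : ℚ) = 1 ∧ (t₂ : ℚ) = 1) ∧ τ₁ = 0 ∧ τ₂ = 0) ∨
        (((t₁ : ℚ) = (e₁ - e₂) * (e₁ - e₃) ∧ (t₂ : ℚ) = e₁ - e₂) ∧ τ₁ = 1 ∧ τ₂ = 1 + ε) ∨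
        (((t₁ : ℚ) = e₂ - e₁ ∧ (t₂ : ℚ) = (e₂ - e₁) * (e₂ - e₃)) ∧ τ₁ = ε ∧ τ₂ = 1) ∨
        (((t₁ : ℚ) = e₃ - e₁ ∧ (t₂ : ℚ) = e₃ - e₂) ∧ τ₁ = 1 + ε ∧ τ₂ = ε)) ∧
      (phi3 (redeiLaplacian Q) *ᵥ χ = fun _ => τ₂ + (ε + 1) * τ₁) ∧ cls t₁ t₂ τ₁ χ = c := by
    intro c hc
    obtain ⟨t₁, t₂, τ₁, τ₂, htor, A, B, hA, hB, hpa0, hpb0, ha, hb, hphi, hindB⟩ :=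
      exists_torsion_phi3_of_mem_selmerGroup E S Q h hS h2S hgood hN hrank hsha hQ hQS hQ4 hk hq₀ hiso8 hisoS hadm hε hd hc
    refine ⟨t₁, t₂, τ₁, τ₂, fun i : Q => if (i : ℕ) ∈ A then (1 : ZMod 2) else 0, htor, hphi, ?_⟩
    set χ : Q → ZMod 2 := fun i : Q => if (i : ℕ) ∈ A then (1 : ZMod 2) else 0 with hχdef
    have hAχ : As χ = A := hAs_eq χ hA fun i => rfl
    have hBχ : As (bv τ₁ χ) = B := hAs_eq _ hB fun j => by rw [hbv]; exact hindB j
    have hu₁ : (Units.mk0 _ (hprod χ) : ℚˣ) = Units.mk0 _ hpa0 := Units.ext (by rw [Units.val_mk0, Units.val_mk0, hAχ])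
    have hu₂ : (Units.mk0 _ (hprod (bv τ₁ χ)) : ℚˣ) = Units.mk0 _ hpb0 :=
      Units.ext (by rw [Units.val_mk0, Units.val_mk0, hBχ])
    rw [hcls, hu₁, hu₂]
    exact ((E.quadraticTwist d).eq_twoDescentClass_of_kummerEquiv_eq h' _ _ ha hb).symm
  -- (5) the four torsion pairs: Selmer membership and bits on `Q`
  have hbits : ∀ q ∈ Q, (hq : q.Prime) → haveI : Fact q.Prime := ⟨hq⟩;
      (parityBit q (1 : ℚ) = 0 ∧ qrBit q (1 : ℚ) = 0) ∧
      (parityBit q ((e₁ - e₂) * (e₁ - e₃)) = 0 ∧ qrBit q ((e₁ - e₂) * (e₁ - e₃)) = 1) ∧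
      (parityBit q (e₁ - e₂) = 0 ∧ qrBit q (e₁ - e₂) = 1 + ε) ∧
      (parityBit q (e₂ - e₁) = 0 ∧ qrBit q (e₂ - e₁) = ε) ∧
      (parityBit q ((e₂ - e₁) * (e₂ - e₃)) = 0 ∧ qrBit q ((e₂ - e₁) * (e₂ - e₃)) = 1) ∧
      (parityBit q (e₃ - e₁) = 0 ∧ qrBit q (e₃ - e₁) = 1 + ε) ∧
      (parityBit q (e₃ - e₂) = 0 ∧ qrBit q (e₃ - e₂) = ε) := by
    intro q hq hqp
    haveI : Fact q.Prime := ⟨hqp⟩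
    obtain ⟨g12, g13, g23⟩ := hgood q hqp (hQS q hq)
    obtain ⟨hδ₁, hδ₂⟩ := hadm q hq hqp
    have hεq := hε q hq hqp
    have hm1 : qrBit q (-1 : ℚ) = 1 := qrBit_neg_one_eq_one_of_emod_four (hQ4 q hq)
    have hq12 : qrBit q (e₁ - e₂) = 1 + ε := by rw [← neg_sub, qrBit_neg (p := q) he21, hm1, hεq]
    have hq13 : qrBit q (e₁ - e₃) = ε := by
      have := hδ₁; rw [qrBit_mul q he12 he13, hq12] at this
      revert this; generalize qrBit q (e₁ - e₃) = x
      rcases zmod2_cases ε with h0 | h0 <;> rw [h0] <;> revert x <;> decide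
    have hq23 : qrBit q (e₂ - e₃) = 1 + ε := by
      have := hδ₂; rw [qrBit_mul q he21 he23, hεq] at this
      revert this; generalize qrBit q (e₂ - e₃) = x
      rcases zmod2_cases ε with h0 | h0 <;> rw [h0] <;> revert x <;> decide
    have p12 : parityBit q (e₁ - e₂) = 0 := by rw [parityBit, g12, Int.cast_zero]
    have p13 : parityBit q (e₁ - e₃) = 0 := by rw [parityBit, g13, Int.cast_zero]
    have p23 : parityBit q (e₂ - e₃) = 0 := by rw [parityBit, g23, Int.cast_zero]
    have p21 : parityBit q (e₂ - e₁) = 0 := by rw [parityBit, ← neg_sub, padicValRat.neg, g12, Int.cast_zero]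
    have p31 : parityBit q (e₃ - e₁) = 0 := by rw [parityBit, ← neg_sub, padicValRat.neg, g13, Int.cast_zero]
    have p32 : parityBit q (e₃ - e₂) = 0 := by rw [parityBit, ← neg_sub, padicValRat.neg, g23, Int.cast_zero]
    refine ⟨⟨by rw [parityBit, padicValRat.one, Int.cast_zero], qrBit_one⟩,
      ⟨by rw [parityBit_mul he12 he13, p12, p13, add_zero], hδ₁⟩, ⟨p12, hq12⟩, ⟨p21, hεq⟩,
      ⟨by rw [parityBit_mul he21 he23, p21, p23, add_zero], hδ₂⟩,
      ⟨p31, by rw [← neg_sub, qrBit_neg (p := q) he13, hm1, hq13]⟩, ⟨p32, ?_⟩⟩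
    rw [← neg_sub, qrBit_neg (p := q) he23, hm1, hq23]
    rcases zmod2_cases ε with h0 | h0 <;> rw [h0] <;> decide
  -- the four torsion pairs as units, their Selmer membership and bit packages
  set T0a : ℚˣ := 1
  set T1a : ℚˣ := Units.mk0 _ (mul_ne_zero he12 he13)
  set T1b : ℚˣ := Units.mk0 _ he12
  set T2a : ℚˣ := Units.mk0 _ he21
  set T2b : ℚˣ := Units.mk0 _ (mul_ne_zero he21 he23)
  set T3a : ℚˣ := Units.mk0 _ he31
  set T3b : ℚˣ := Units.mk0 _ he32
  have hO : E.twoDescentClass h (1 : ℚˣ) 1 ∈ E.selmerGroup 2 := by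
    rw [← E.eq_twoDescentClass_of_kummerEquiv_eq h 1 1 (c := 0)
      (by rw [_root_.map_zero, _root_.map_zero, QuotientGroup.mk_one, ofMul_one])
      (by rw [_root_.map_zero, _root_.map_zero, QuotientGroup.mk_one, ofMul_one])]
    exact zero_mem _
  have hT1 : E.twoDescentClass h T1a T1b ∈ E.selmerGroup 2 := twoDescentClass_mem_selmerGroup_T₁ E h _ _ rfl rfl
  have hT2 : E.twoDescentClass h T2a T2b ∈ E.selmerGroup 2 := twoDescentClass_mem_selmerGroup_T₂ E h _ _ rfl rfl
  have hT3 : E.twoDescentClass h T3a T3b ∈ E.selmerGroup 2 := twoDescentClass_mem_selmerGroup_T₃ E h _ _ rfl rfl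
  have hτ0 : ∀ q ∈ Q, (hq : q.Prime) → haveI : Fact q.Prime := ⟨hq⟩;
      parityBit q ((1 : ℚˣ) : ℚ) = 0 ∧ parityBit q ((1 : ℚˣ) : ℚ) = 0 ∧ qrBit q ((1 : ℚˣ) : ℚ) = 0 ∧ qrBit q ((1 : ℚˣ) : ℚ) = 0 :=
    fun q hq hqp => by obtain ⟨hO', -⟩ := hbits q hq hqp; rw [Units.val_one]; exact ⟨hO'.1, hO'.1, hO'.2, hO'.2⟩
  have hτ1 : ∀ q ∈ Q, (hq : q.Prime) → haveI : Fact q.Prime := ⟨hq⟩;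
      parityBit q (T1a : ℚ) = 0 ∧ parityBit q (T1b : ℚ) = 0 ∧ qrBit q (T1a : ℚ) = 1 ∧ qrBit q (T1b : ℚ) = 1 + ε :=
    fun q hq hqp => by obtain ⟨-, h1, h2, -⟩ := hbits q hq hqp; exact ⟨h1.1, h2.1, h1.2, h2.2⟩
  have hτ2 : ∀ q ∈ Q, (hq : q.Prime) → haveI : Fact q.Prime := ⟨hq⟩;
      parityBit q (T2a : ℚ) = 0 ∧ parityBit q (T2b : ℚ) = 0 ∧ qrBit q (T2a : ℚ) = ε ∧ qrBit q (T2b : ℚ) = 1 :=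
    fun q hq hqp => by obtain ⟨-, -, -, h1, h2, -⟩ := hbits q hq hqp; exact ⟨h1.1, h2.1, h1.2, h2.2⟩
  have hτ3 : ∀ q ∈ Q, (hq : q.Prime) → haveI : Fact q.Prime := ⟨hq⟩;
      parityBit q (T3a : ℚ) = 0 ∧ parityBit q (T3b : ℚ) = 0 ∧ qrBit q (T3a : ℚ) = 1 + ε ∧ qrBit q (T3b : ℚ) = ε :=
    fun q hq hqp => by obtain ⟨-, -, -, -, -, h1, h2⟩ := hbits q hq hqp; exact ⟨h1.1, h2.1, h1.2, h2.2⟩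
  -- the parameter type: disjoint union of the four fibres of `Φ₃(Ĝ)`
  let Fib : ZMod 2 → ZMod 2 → Type := fun τ₁ τ₂ =>
    {χ : Q → ZMod 2 // phi3 (redeiLaplacian Q) *ᵥ χ = fun _ => τ₂ + (ε + 1) * τ₁}
  let ψ : ∀ (t₁ t₂ : ℚˣ) (τ₁ τ₂ : ZMod 2), E.twoDescentClass h t₁ t₂ ∈ E.selmerGroup 2 →
      (∀ q ∈ Q, (hq : q.Prime) → haveI : Fact q.Prime := ⟨hq⟩;
        parityBit q (t₁ : ℚ) = 0 ∧ parityBit q (t₂ : ℚ) = 0 ∧ qrBit q (t₁ : ℚ) = τ₁ ∧ qrBit q (t₂ : ℚ) = τ₂) →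
      Fib τ₁ τ₂ → selmerGroup (E.quadraticTwist d) 2 :=
    fun t₁ t₂ τ₁ τ₂ ht hτ χ => ⟨cls t₁ t₂ τ₁ χ.1, hmem t₁ t₂ τ₁ τ₂ ht hτ χ.1 χ.2⟩
  let Ψ : (Fib 0 0 ⊕ (Fib 1 (1 + ε) ⊕ (Fib ε 1 ⊕ Fib (1 + ε) ε))) → selmerGroup (E.quadraticTwist d) 2 :=
    Sum.elim (ψ 1 1 0 0 hO hτ0) (Sum.elim (ψ T1a T1b 1 (1 + ε) hT1 hτ1)
      (Sum.elim (ψ T2a T2b ε 1 hT2 hτ2) (ψ T3a T3b (1 + ε) ε hT3 hτ3)))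
  -- injectivity of each `ψ` and disjointness of their images
  have hψinj : ∀ (t₁ t₂ : ℚˣ) (τ₁ τ₂ : ZMod 2) ht hτ, Function.Injective (ψ t₁ t₂ τ₁ τ₂ ht hτ) := by
    intro t₁ t₂ τ₁ τ₂ ht hτ χ χ' heq
    have := congrArg Subtype.val heq
    exact Subtype.ext (hinj t₁ t₂ τ₁ τ₂ t₁ t₂ τ₁ τ₂ χ.1 χ'.1 hτ hτ this).1
  have hψne : ∀ (t₁ t₂ : ℚˣ) (τ₁ τ₂ : ZMod 2) ht hτ (t₁' t₂' : ℚˣ) (τ₁' τ₂' : ZMod 2) ht' hτ',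
      ¬ (τ₁ = τ₁' ∧ τ₂ = τ₂') → ∀ (χ : Fib τ₁ τ₂) (χ' : Fib τ₁' τ₂'),
        ψ t₁ t₂ τ₁ τ₂ ht hτ χ ≠ ψ t₁' t₂' τ₁' τ₂' ht' hτ' χ' := by
    intro t₁ t₂ τ₁ τ₂ ht hτ t₁' t₂' τ₁' τ₂' ht' hτ' hne χ χ' heq
    have := congrArg Subtype.val heq
    obtain ⟨-, h₁, h₂⟩ := hinj t₁ t₂ τ₁ τ₂ t₁' t₂' τ₁' τ₂' χ.1 χ'.1 hτ hτ' this
    exact hne ⟨h₁, h₂⟩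
  -- the four bit-pairs are pairwise distinct
  have d01 : ¬ ((0 : ZMod 2) = 1 ∧ (0 : ZMod 2) = 1 + ε) := fun h0 => zero_ne_one h0.1
  have d02 : ¬ ((0 : ZMod 2) = ε ∧ (0 : ZMod 2) = 1) := fun h0 => zero_ne_one h0.2
  have d03 : ¬ ((0 : ZMod 2) = 1 + ε ∧ (0 : ZMod 2) = ε) := by
    rcases zmod2_cases ε with h0 | h0 <;> rw [h0] <;> decide
  have d12 : ¬ ((1 : ZMod 2) = ε ∧ 1 + ε = 1) := by rcases zmod2_cases ε with h0 | h0 <;> rw [h0] <;> decide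
  have d13 : ¬ ((1 : ZMod 2) = 1 + ε ∧ 1 + ε = ε) := by rcases zmod2_cases ε with h0 | h0 <;> rw [h0] <;> decide
  have d23 : ¬ (ε = 1 + ε ∧ (1 : ZMod 2) = ε) := by rcases zmod2_cases ε with h0 | h0 <;> rw [h0] <;> decide
  have hΨinj : Function.Injective Ψ := by
    refine Function.Injective.sumElim (hψinj 1 1 0 0 hO hτ0) ?_ ?_
    · refine Function.Injective.sumElim (hψinj T1a T1b 1 (1 + ε) hT1 hτ1) ?_ ?_
      · refine Function.Injective.sumElim (hψinj T2a T2b ε 1 hT2 hτ2) (hψinj T3a T3b (1 + ε) ε hT3 hτ3) ?_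
        exact fun a b => hψne T2a T2b ε 1 hT2 hτ2 T3a T3b (1 + ε) ε hT3 hτ3 d23 a b
      · rintro a (b | b)
        · exact hψne T1a T1b 1 (1 + ε) hT1 hτ1 T2a T2b ε 1 hT2 hτ2 d12 a b
        · exact hψne T1a T1b 1 (1 + ε) hT1 hτ1 T3a T3b (1 + ε) ε hT3 hτ3 d13 a b
    · rintro a (b | b | b)
      · exact hψne 1 1 0 0 hO hτ0 T1a T1b 1 (1 + ε) hT1 hτ1 d01 a b
      · exact hψne 1 1 0 0 hO hτ0 T2a T2b ε 1 hT2 hτ2 d02 a b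
      · exact hψne 1 1 0 0 hO hτ0 T3a T3b (1 + ε) ε hT3 hτ3 d03 a b
  have hΨsurj : Function.Surjective Ψ := by
    rintro ⟨c, hc⟩
    obtain ⟨t₁, t₂, τ₁, τ₂, χ, htor, hphi, hcl⟩ := hsurj c hc
    rcases htor with ⟨⟨h₁, h₂⟩, rfl, rfl⟩ | ⟨⟨h₁, h₂⟩, rfl, rfl⟩ | ⟨⟨h₁, h₂⟩, rfl, rfl⟩ | ⟨⟨h₁, h₂⟩, rfl, rfl⟩
    · have ht : t₁ = 1 ∧ t₂ = 1 := ⟨Units.ext h₁, Units.ext h₂⟩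
      obtain ⟨rfl, rfl⟩ := ht
      exact ⟨Sum.inl ⟨χ, hphi⟩, Subtype.ext hcl⟩
    · have ht : t₁ = T1a ∧ t₂ = T1b := ⟨Units.ext h₁, Units.ext h₂⟩
      obtain ⟨rfl, rfl⟩ := ht
      exact ⟨Sum.inr (Sum.inl ⟨χ, hphi⟩), Subtype.ext hcl⟩
    · have ht : t₁ = T2a ∧ t₂ = T2b := ⟨Units.ext h₁, Units.ext h₂⟩
      obtain ⟨rfl, rfl⟩ := ht
      exact ⟨Sum.inr (Sum.inr (Sum.inl ⟨χ, hphi⟩)), Subtype.ext hcl⟩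
    · have ht : t₁ = T3a ∧ t₂ = T3b := ⟨Units.ext h₁, Units.ext h₂⟩
      obtain ⟨rfl, rfl⟩ := ht
      exact ⟨Sum.inr (Sum.inr (Sum.inr ⟨χ, hphi⟩)), Subtype.ext hcl⟩
  -- count
  have hcount : ∀ τ₁ τ₂ : ZMod 2, Nat.card (Fib τ₁ τ₂) = Nat.card (LinearMap.ker (phi3 (redeiLaplacian Q)).mulVecLin) :=
    fun τ₁ τ₂ => natCard_phi3_fiber_eq Q _
  rw [← Nat.card_eq_of_bijective Ψ ⟨hΨinj, hΨsurj⟩, Nat.card_sum, Nat.card_sum, Nat.card_sum, hcount, hcount, hcount,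
    hcount]
  ring

end Count

end Summit.BirchSwinnertonDyer.BirchSwinnertonDyer.Theorems.GenusKolyvaginAtTwo.TorsionCellSEL

end
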